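import Summits.ValiantsHypothesis.ValiantsHypothesis.Theses.GrenetZeon
import Summits.ValiantsHypothesis.ValiantsHypothesis.Theorems.FreeFermionCLLDcqpToVH
import Literature.Computability.AlgebraicComplexity.DeterminantalComplexityProofs
import Summits.ValiantsHypothesis.ValiantsHypothesis.Theorems.SymPencilSdcThesisSplit

/-!
# Route GrenetZeon — the glue items `SliceToDetqp` (stmt-ValiantsHypothesis-8070),
# `AbelianToDetqp` (stmt-ValiantsHypothesis-8071) and `Assembly` (stmt-ValiantsHypothesis-8072)

Three bookkeeping items of route `GrenetZeon` (two-parameter "`(m, s)`-representations": `per_n` as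
an `m × m` affine determinant over a commutative `ℂ`-algebra `R` of dimension `≤ s`, read through a
linear functional `l : R → ℂ`), each marked `provable-now` with candidate proofs on file since
2026-08-15/17 and never landed (Theorems/ is prover-only):

* `sliceToDetqp_proof` — the `s = 1` slice: the two-parameter thesis `AlgDcQP` implies route DetQP's
  thesis `¬ IsQPBounded (n ↦ dc(per_n))`: a quasi-polynomial bound on `dc` gives, for every `n`, an
  affine determinantal representation of `per_n` of size `≤ 2^((log₂ n + c)^c)`
  (`hasDetRepr_iff_determinantalComplexity_le_holds`), i.e. an `(m, 1)`-representation over `R = ℂ`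
  with `l = id`, which `AlgDcQP c` forbids for large `n`.
* `abelianToDetqp_proof` — `AbelianizationQP → PolySizeQPAlgebra → ¬ IsQPBounded dc(per)`: a qp bound
  gives representations of qp size, abelianised (first hypothesis) to size `n^a + a` over an algebra of
  dimension `2^((log₂ m + a)^a) ≤ 2^((log₂ n + e)^e)`, `e = (c+1)(a+1)` (qp ∘ qp = qp, the tree's
  `SymPencilSdcThesisSplit.qpBound_comp_qpBound`),
  which `PolySizeQPAlgebra e` forbids for large `n`.
* `assembly_proof` — `AlgDcQP → ValiantsHypothesis`, through `sliceToDetqp_proof` and the tree's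
  `Summit.ValiantsHypothesis.Theorems.dcqpToVH_proof_grenetZeon` (`¬ IsQPBounded dc(per) → VH`).

Honest framing: implications between OPEN route statements and the summit; nothing here is progress
on `VP ≠ VNP`.
-/

set_option linter.dupNamespace false

namespace Summit.ValiantsHypothesis.ValiantsHypothesis.Theorems.GrenetZeon

open Literature.Computability.AlgebraicComplexity
open Summit.ValiantsHypothesis.ValiantsHypothesis.Theses.GrenetZeon

/-- An affine determinantal representation over `ℂ` is an `(m, 1)`-representation in the route's
two-parameter sense (`R = ℂ`, `l = id`, `finrank ℂ ℂ = 1`). [folklore] -/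
theorem exists_rep_of_hasDetRepr {n m : ℕ} (h : HasDetRepr (perPoly (Fin n) ℂ) m) {s : ℕ} (hs : 1 ≤ s) :
    ∃ (R : Type) (_ : CommRing R) (_ : Algebra ℂ R) (_ : Module.Finite ℂ R),
      Module.finrank ℂ R ≤ s ∧ ∃ (l : R →ₗ[ℂ] ℂ) (A : Matrix (Fin m) (Fin m) (MvPolynomial (Fin n × Fin n) R)),
        (∀ i j, (A i j).totalDegree ≤ 1) ∧
          ∀ d : (Fin n × Fin n) →₀ ℕ, l (MvPolynomial.coeff d A.det) =
            MvPolynomial.coeff d (perPoly (Fin n) ℂ) := by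
  obtain ⟨A, hA, hdet⟩ := h
  refine ⟨ℂ, inferInstance, inferInstance, inferInstance, ?_, LinearMap.id, A, hA, fun d => ?_⟩
  · rw [Module.finrank_self]
    exact hs
  · rw [hdet, LinearMap.id_apply]

/-- **Item `SliceToDetqp` (stmt-ValiantsHypothesis-8070), PROVED** — the `s = 1` slice of the
two-parameter thesis is DetQP's thesis. [folklore] -/
theorem sliceToDetqp_proof : SliceToDetqp := by
  intro hX hqp
  obtain ⟨c, hc⟩ := hqp
  obtain ⟨n₀, hn₀⟩ := hX c
  have hs : 1 ≤ 2 ^ ((Nat.log 2 n₀ + c) ^ c) := Nat.one_le_two_pow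
  have hrep : HasDetRepr (perPoly (Fin n₀) ℂ) (2 ^ ((Nat.log 2 n₀ + c) ^ c)) :=
    (hasDetRepr_iff_determinantalComplexity_le_holds (perPoly (Fin n₀) ℂ) _).2 (hc n₀)
  exact hn₀ n₀ le_rfl _ 1 le_rfl hs (exists_rep_of_hasDetRepr hrep le_rfl)

/-- Monotonicity of the polynomial template: `n^a + a ≤ n^e + e` for `a ≤ e`, `1 ≤ n`. [folklore] -/
theorem pow_add_le_pow_add {n a e : ℕ} (hn : 1 ≤ n) (hae : a ≤ e) : n ^ a + a ≤ n ^ e + e :=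
  Nat.add_le_add (Nat.pow_le_pow_right hn hae) hae

/-- **Item `AbelianToDetqp` (stmt-ValiantsHypothesis-8071), PROVED** — abelianisation at
quasi-polynomial cost plus the polynomial-size exclusion give DetQP's thesis. [folklore] -/
theorem abelianToDetqp_proof : AbelianToDetqp := by
  intro hAb hPoly hqp
  obtain ⟨c, hc⟩ := hqp
  obtain ⟨a, ha⟩ := hAb
  set e := (c + 1) * (a + 1) with he
  obtain ⟨n₀, hn₀⟩ := hPoly e
  set n := max n₀ 1 with hn
  have hn1 : 1 ≤ n := le_max_right _ _
  have hrep : HasDetRepr (perPoly (Fin n) ℂ) (2 ^ ((Nat.log 2 n + c) ^ c)) :=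
    (hasDetRepr_iff_determinantalComplexity_le_holds (perPoly (Fin n) ℂ) _).2 (hc n)
  obtain ⟨R, _, _, _, hdim, l, A, hA, hcoeff⟩ := ha n _ hn1 hrep
  have hae : a ≤ e := by
    rw [he]
    nlinarith
  refine hn₀ n (le_max_left _ _) (n ^ a + a) (2 ^ ((Nat.log 2 (2 ^ ((Nat.log 2 n + c) ^ c)) + a) ^ a))
    (pow_add_le_pow_add hn1 hae) (SymPencilSdcThesisSplit.qpBound_comp_qpBound le_rfl) ?_
  exact ⟨R, inferInstance, inferInstance, inferInstance, hdim, l, A, hA, hcoeff⟩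

/-- **Item `Assembly` (stmt-ValiantsHypothesis-8072), PROVED** — `AlgDcQP → ValiantsHypothesis`: the
`s = 1` slice gives DetQP's thesis (`sliceToDetqp_proof`), which gives the summit by the tree's
`dcqpToVH_proof_grenetZeon` (VP families have qp-bounded `dc`, `per ∈ VNP`).
[cite: BurgisserClausenShokrollahi1997, Cor. (21.40)] -/
theorem assembly_proof : Assembly :=
  fun hX => Summit.ValiantsHypothesis.Theorems.dcqpToVH_proof_grenetZeon (sliceToDetqp_proof hX)

end Summit.ValiantsHypothesis.ValiantsHypothesis.Theorems.GrenetZeon
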